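import Literature.NumberTheory.EllipticCurves.BurungaleSkinnerTianWan2024.CyclotomicPConverseOverQProofs
import Literature.NumberTheory.EllipticCurves.AnomalousOfRationalTorsionProofs
import HarnessLib

/-!
# Burungale–Skinner–Tian–Wan (arXiv:2409.01350v2, PREPRINT), §10.4.2 Thm. 10.10 (a) "Ordinary main
# conjecture" for an elliptic curve, BOTH clauses — the semistable clause AND the quadratic-twist
# clause "(D_K, Np) = 1" — as OPEN claim-tagged binders whose CONCLUSION is Kato's statement 9.3 (b)
# in the tree's Literature currency `CharIdealEqPadicLFunctionNeron`; plus the kernel corollary at p = 3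

Written by the typer seat `bsd-littype-01` (gen 6) of the cross-ladder literature-typing layer
(D-0088(4); cell `run/shared/lean/pub/bsd-littype/`). HONEST FRAMING: UNREFEREED preprint ⇒
explicitly labelled OPEN hypotheses only (`def … : Prop`, `[claim: …, status: under-review]`), NEVER
theorems, NEVER `[cite:]`-facts; nothing asserted about any curve; no `_holds`. No new notion: the
conclusion is the predicate-with-body `CharIdealEqPadicLFunctionNeron W p` of
`CyclotomicMainStatementRankOneBSDOPEN.lean` (gen 2: "`char_Λ X(E/ℚ_∞) = (g)`, `ι g = ϖ · L_p(f, α)`",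
INTEGRAL, Néron normalisation = BSTW statement 9.3 (b) for `g = f_E`; `Iff.rfl` with the Summits-side
typed input (MC) of `Theorems/Rank1ResidualX1Defs.lean`). Ordinary twin of gen 3's
`SignedMainStatementSemistableOPEN.lean` (Thm. 10.1, supersingular).

WHY (the typed gap this closes). The gen-2 census (`QuadraticTwistPPartOPEN.lean`, "WHAT IS NOT HERE")
left Thm. 10.10 (a) untyped as "= the tree's PUBLISHED
`BurungaleCastellaSkinner2025.thm112b_charIdeal_eq_padicLFunction_integral` for semistable `E`, another
proof". That identification is too quick: BCS25 Thm. 1.1.2 (b) is stated for `3 < p` AND under (im)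
(`BigIm W p`); BSTW Thm. 10.10 (a) is stated for EVERY ordinary `p ∤ 2N` — so `p = 3` INCLUDED — under
(irr_ℚ) ALONE (Conj. 9.3 (b): "in `Λ_{𝒪_λ} ⊗ ℚ_p` and even in `Λ_{𝒪_λ}` if (irr_ℚ) holds for `p ≠ 2`"),
for semistable `E` (`N` square-free) and its prime-to-`Np` quadratic twists. The surplus over refereed
print is exactly (i) `p = 3` and (ii) no (im)/(ram): at `p = 3` the tree's only REFEREED supplier of
the cyclotomic main conj. for `E/ℚ` is `skinner_urban_main_conjecture W 3` ((irr)+(ram); PROOF-INPUT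
FLAG `SU14-12.3.6-mu@nonsplit@3`, ACTIVE-PRINT-GAP, priced PUB\*), whose printed retirement
condition (referee A R152.2 (g)) names "a BSTW journal version"; Rem. 10.11: "Part (a) gives a
different proof of a special case of Theorem 9.21 (c)" — i.e. of the Skinner–Urban statement — by the
paper's zeta-element method (Thm. 9.24 + Thm. 10.5/10.8 pattern, "One may proceed just as in the proof
of Theorem 10.8"), NOT by Eisenstein congruences on `U(2,2)`. This file types that claim so that the
`p = 3` consumers (X10 / K6 / CountingDoorF2AtThree / KimAtThreeKolyvagin `hSU` sockets; bsd-cited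
ARM P R-01) can price the PREPRINT road (PRE) next to the Skinner–Urban road (PUB\*) BY NAME — for
SEMISTABLE curves with `E[3]` irreducible and WITHOUT (ram).

## The printed statement (arXiv:2409.01350v2, p. 89; TeX label `IMC_ord`, tex l.7519–7527)

> **Theorem 10.10.** Let `g ∈ S₂(Γ₀(N))` be an elliptic newform with `N` square-free and `p ∤ 2N` an
> ordinary prime such that (irr_ℚ) holds. (a) Conjecture 9.3 is true. (b) Let `L` be an imaginary
> quadratic field satisfying `(D_L, 2N) = 1`, (2.15) and (irr_L). Suppose that either the condition
> (def) or (indef) holds. Then Conjectures 9.10 and 9.12 are true. Moreover, the same holds for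
> `g_K := g ⊗ χ_K` for any quadratic field extension `K/ℚ` with `(D_K, Np) = 1`.
> *Proof.* One may proceed just as in the proof of Theorem 10.8. **Remark 10.11.** Part (a) gives a
> different proof of a special case of Theorem 9.21 (c). …

Conj. 9.3 (label `KatopL`, p. 80, tex l.6791–6803): "Let `g` be an elliptic newform, `p ∤ N` a prime of
ordinary reduction, `α` the `p`-unit root … (a) `X(g)` is `Λ_{𝒪_λ}`-torsion. (b) For `ω` good and
`γ = γ_g` as in Lemma 2.5, we have an equality of ideals `(𝓛_{α,ω,γ}(g)) = ξ(X(g))` in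
`Λ_{𝒪_λ} ⊗_{ℤ_p} ℚ_p` and even in `Λ_{𝒪_λ}` if (irr_ℚ) holds for `p ≠ 2`."

## Transcription (elliptic-curve instance `g = f_E`, `𝒪_λ = ℤ_p`), part (a) only

* Semistable clause (`thm1010a_mainStatement_semistable_ordinary_OPEN`): `W` globally minimal,
  `Semistable W` ("`N` square-free" for an elliptic newform = every bad prime multiplicative), `p ≠ 2`,
  good reduction at `p` with `p ∤ a_p` (ordinary), `E[p]` irreducible (irr_ℚ); conclusion
  `CharIdealEqPadicLFunctionNeron W p` — 9.3 (a)+(b), INTEGRAL (print: "in `Λ` if (irr_ℚ), `p ≠ 2`",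
  both in force).
* Twist clause (`thm1010_twist_mainStatement_OPEN`): `W₀` as above; `K = ℚ(√d)`, `d ≠ 1` square-free;
  "`(D_K, Np) = 1`" ↦ every prime `q` ramified in `K` (`RamifiedInQuadratic d q`: `q ∣ d`, or `q = 2` and
  `d ≢ 1 (mod 4)`) has `q ≠ p` and `q ∤ N_{E₀}` — verbatim the spelling of gen 3's
  `thm101_twist_signedMainStatement_OPEN` and gen 2's `cor102_twist_pPart_OPEN`; `W` a globally minimal
  model of `E₀ ⊗ χ_K = E₀^{(d)}` (`C • W = W₀.quadraticTwist d`); conclusion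
  `CharIdealEqPadicLFunctionNeron W p` (the twist is good ordinary at `p ∤ d` with `E₀^{(d)}[p]`
  irreducible — tree theorems `isOrdinaryAt_of_smul_eq_quadraticTwist`,
  `hasIrreducibleModPGaloisRep_of_smul_eq_quadraticTwist`; not needed syntactically).
* READING FLAG `BSTW-1111-lattice` (as in the gen-2 ordinary Prop. 11.11 file, verbatim): print states
  9.3 (b) for `ω` good and `γ_g` = the OPTIMAL (Néron-of-`E_•`) periods of the isogeny class (Rem. 2.3,
  Lemma 2.5); the predicate uses the Néron period of the GIVEN globally minimal `W`; under (irr_ℚ) the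
  class has no `p`-isogeny and `p ∤` Manin constant at `p ∤ 2N` (Mazur 1978 / Abbes–Ullmo 1996), so the
  two normalisations differ by a `p`-adic unit — published, not restated; the binders are EQUIVALENT to
  print on this point and otherwise WEAKER-OR-EQUAL, never stronger.
* Part (b) (Conj. 9.10 two-variable ordinary / Conj. 9.12 Greenberg over `L` under (def)/(indef)) is
  NOT typed here — a typed GAP, now typable over the Yan–Zhu 2026 carriers (`XOrd₂`/`XGr₂`,
  `IsGreenbergLFunctionAnyRoot₂`; an `L`-size statement with the `v ↔ v̄` convention of
  OPEN-QUESTIONS-01 Q21), left to a successor or to the K3 cells.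

## What is PROVED here (bookkeeping + one kernel corollary; all CONDITIONAL on the OPEN binders)

* `charIdealLePadicLFunctionRat_of_thm1010a_OPEN`, `charIdealLePadicLFunctionRat_twist_of_thm1010_OPEN`:
  the binders feed the one-sided rational ordinary predicate `CharIdealLePadicLFunctionRat` of
  `CyclotomicPConverseCriterionOPEN` (for `E` resp. for a prime-to-`Np` twist), the shape consumed by
  the Prop. 12.1 binder and by gen 5/6's Thm. 12.3 replays — at EVERY `p ≠ 2`, no (ram), no (im).
* `analyticRank_eq_one_of_prop121_ordinary_OPEN_of_thm1010_OPEN_of_selmerCorank_eq_one` (+ rank form):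
  for `W/ℚ` globally minimal and SEMISTABLE, `p ≠ 2` good ordinary with `E[p]` irreducible,
  `corank_{ℤ_p} Sel_{p^∞}(E/ℚ) = 1 ∧ #Ш(E/ℚ)[p^∞] < ∞ ⟹ ord_{s=1} L(E, s) = 1`, modulo THREE preprint
  binders (Prop. 12.1 ordinary, Thm. 10.10 (a) semistable, Thm. 10.10 twist) + parity +
  Friedberg–Hoffstein + Kato 14.2 + modularity, by the printed proof of Thm. 12.3 (steps 1–6, module
  docstring of `CyclotomicPConverseOverQProofs`) with step 5 read "By Theorem 10.10 (a) [instead of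
  9.21 (c)] … Kato's main conjecture holds for `g` and the quadratic twist `g'`" (`g' = g ⊗ χ_L`,
  `(D_L, Np) = 1` by (ord) + (Heeg)). HONESTY: this is a COROLLARY OF THE PAPER'S OWN STATEMENTS
  (10.10 (a) + 12.1), NOT a transcription of Thm. 12.3 — print's Thm. 12.3 asks (ram) at `p = 3` and
  does not ask `N` square-free in its ordinary branch (the (ram) version is gen 6's
  `analyticRank_eq_one_of_prop121_ordinary_OPEN_of_skinnerUrban_of_selmerCorank_eq_one`, Skinner–Urban
  PUB\* at `3`; the `p ≥ 5` (ram)-free version is gen 5's, BCS25 PUB). At `p = 3` it is the ONLY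
  typed road for semistable curves WITHOUT a ramified multiplicative prime (all of whose inputs are
  the preprint's announced theorems or refereed print).

* (appended, v2) `bsdp_rankOne_of_prop1111_OPEN_of_thm1010_OPEN`: the RANK-ONE companion — for
  `W/ℚ` globally minimal and SEMISTABLE, `p ≠ 2` good ordinary with `E[p]` irreducible,
  `ord_{s=1} L(E,s) = 1`, and a Heegner field `K` (imaginary quadratic, `p` split, (Heeg) for `N_E`,
  `ord_{s=1} L(E/K,s) = 1` as `LDerivEK W K ≠ 0`) with ANY globally minimal model `W'` of `E^{(d_K)}`:
  Miller's `BSD(E,p)`, modulo THREE preprint binders (Prop. 11.11 ordinary = gen 2's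
  `prop1111_pPart_rankOne_of_mainStatements_ordinary_OPEN`, Thm. 10.10 (a) semistable, Thm. 10.10
  twist) + modularity + GZK; the binder's side conditions (coprime), (van_ℚ), (van_L) are DERIVED
  ((Heeg) ⟹ (coprime); `E[p]` irreducible ⟹ `p ∤ #E(ℚ)_tors`, and likewise for the twist, whose
  `p`-torsion is irreducible too). HONESTY: a COROLLARY OF THE PAPER'S OWN STATEMENTS (11.11 + 10.10),
  NOT a transcription of Thm. 11.12 / Thm. 1.9 — whose ordinary branch asks (irr_ℚ) AND (ram) at every
  `p` (`thm1112_pPart_rankOne_OPEN`); this road needs no (ram) but needs `N` square-free.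

## References
* [BurungaleSkinnerTianWan2024] arXiv:2409.01350v2: Thm. 10.10 and Rem. 10.11 (p. 89; label IMC_ord,
  tex l.7519–7533), Conj. 9.3 (p. 80; label KatopL, l.6791–6803), Thm. 9.21 (c) (p. 84; KaMC_r),
  Thm. 12.3 and its proof (p. 96; l.8146–8177), Prop. 12.1 (p. 95), Rem. 2.3 / Lemma 2.5 (periods).
* [BurungaleCastellaSkinner2025] IMRN 2025, Thm. 1.1.2 (b) (`3 < p`, (im)) — the refereed neighbour.
* [SkinnerUrban2014] Invent. Math. 195, Thm. 3.6.9 — the refereed `p ≥ 3` neighbour ((irr)+(ram)).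
* [Mazur1978] / [AbbesUllmo1996] (Manin constant at `p ∤ 2N`) — READING FLAG `BSTW-1111-lattice`.
-/

noncomputable section

open scoped Classical

open WeierstrassCurve NumberField IsDedekindDomain Literature.NumberTheory.EllipticCurves
  Literature.NumberTheory.EllipticCurves.ModularForms
  Literature.NumberTheory.EllipticCurves.Rank1Residual

namespace Literature.NumberTheory.EllipticCurves.BurungaleSkinnerTianWan2024

/-! ### The OPEN binders: Thm. 10.10 (a), semistable clause and twist clause -/

/-- **OPEN HYPOTHESIS — UNREFEREED PREPRINT (arXiv:2409.01350v2), Thm. 10.10 (a), SEMISTABLE clause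
(p. 89).** "Let `g ∈ S₂(Γ₀(N))` be an elliptic newform with `N` square-free and `p ∤ 2N` an ordinary
prime such that (irr_ℚ) holds. (a) Conj[.] 9.3 is true" — i.e. (9.3, p. 80) "`X(g)` is
`Λ_{𝒪_λ}`-torsion [and] `(𝓛_{α,ω,γ}(g)) = ξ(X(g))` in `Λ_{𝒪_λ} ⊗ ℚ_p` and even in `Λ_{𝒪_λ}` if
(irr_ℚ) holds for `p ≠ 2`". Transcribed for `g = f_E`: `W` globally minimal, `Semistable W`, `p ≠ 2`,
good at `p`, `p ∤ a_p`, `E[p]` irreducible; conclusion `CharIdealEqPadicLFunctionNeron W p` (INTEGRAL,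
Néron normalisation; READING FLAG `BSTW-1111-lattice`, module docstring). NOT the tree's refereed
BCS25 1.1.2 (b) (`3 < p`, (im)) nor Skinner–Urban 3.6.9 ((ram)): `p = 3` is included and neither (im)
nor (ram) is asked. NEVER cite this `Prop` as a theorem (no journal version, 2026-08-27); take it as an
explicit hypothesis. [claim: BurungaleSkinnerTianWan2024, status: under-review]
[cite: BurungaleSkinnerTianWan2024, Thm. 10.10 (a), first sentence (p. 89; label IMC_ord, tex l.7519–7522; ANNOUNCED, OPEN binder) with statement 9.3 (p. 80; label KatopL)] -/
def thm1010a_mainStatement_semistable_ordinary_OPEN : Prop :=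
  ∀ (W : WeierstrassCurve ℚ) [W.IsElliptic] [W.IsGloballyMinimal] (p : ℕ) [Fact p.Prime],
    p ≠ 2 → Semistable W → W.HasGoodReductionAtPrime p → ¬ (p : ℤ) ∣ W.frobeniusTrace p →
    W.HasIrreducibleModPGaloisRep p → CharIdealEqPadicLFunctionNeron W p

/-- **OPEN HYPOTHESIS — UNREFEREED PREPRINT (arXiv:2409.01350v2), Thm. 10.10, QUADRATIC-TWIST clause
of part (a) (p. 89).** "Moreover, the same holds for `g_K := g ⊗ χ_K` for any quadratic field extension
`K/ℚ` with `(D_K, Np) = 1`" (`g` an elliptic newform of square-free level `N`, `p ∤ 2N` ordinary,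
(irr_ℚ)). Transcribed (module docstring): `W₀` globally minimal, `Semistable W₀`, `p ≠ 2`, good
ordinary at `p`, `E₀[p]` irreducible; `K = ℚ(√d)`, `d ≠ 1` square-free, every prime ramified in `K` is
`≠ p` and `∤ N_{E₀}` (`RamifiedInQuadratic`, the spelling of `thm101_twist_signedMainStatement_OPEN` /
`cor102_twist_pPart_OPEN`); `W` a globally minimal model of `E₀ ⊗ χ_K = E₀^{(d)}`
(`C • W = W₀.quadraticTwist d`); conclusion `CharIdealEqPadicLFunctionNeron W p` (statement 9.3 for
`g_K`, INTEGRAL). Proof in print: "One may proceed just as in the proof of Theorem 10.8", resting on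
Thm. 9.24's twist clause ("not explicitly covered by [W1, CLW], but essentially the same argument
applies", p. 86) — OPEN-QUESTIONS-01 Q17. NEVER cite this `Prop` as a theorem; take it as an explicit
hypothesis. [claim: BurungaleSkinnerTianWan2024, status: under-review]
[cite: BurungaleSkinnerTianWan2024, Thm. 10.10, last sentence (p. 89; label IMC_ord, tex l.7525; ANNOUNCED, OPEN binder)] -/
def thm1010_twist_mainStatement_OPEN : Prop :=
  ∀ (W₀ W : WeierstrassCurve ℚ) [W₀.IsElliptic] [W₀.IsGloballyMinimal] [W.IsElliptic]
    [W.IsGloballyMinimal] (p : ℕ) [Fact p.Prime] (d : ℤ) (C : VariableChange ℚ),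
    p ≠ 2 → Semistable W₀ → W₀.HasGoodReductionAtPrime p → ¬ (p : ℤ) ∣ W₀.frobeniusTrace p →
    W₀.HasIrreducibleModPGaloisRep p → Squarefree d → d ≠ 1 →
    (∀ (q : ℕ) [Fact q.Prime], RamifiedInQuadratic d q → q ≠ p ∧ ¬ q ∣ W₀.conductorNorm ℤ) →
    C • W = W₀.quadraticTwist (d : ℚ) → CharIdealEqPadicLFunctionNeron W p

/-! ### Bookkeeping (binder ⇒ shape), all CONDITIONAL on the OPEN binders; nothing is closed -/

/-- **Granted the semistable binder: the one-sided rational ordinary predicate** — for `W/ℚ`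
globally minimal and semistable, `p ≠ 2` good ordinary with `E[p]` irreducible,
`CharIdealLePadicLFunctionRat W p` (the shape the Prop. 12.1 binder and the Thm. 12.3 replays
consume), via `charIdealLePadicLFunctionRat_of_charIdealEq`. No (ram), no (im), `p = 3` allowed.
CONDITIONAL; closes nothing. [claim: BurungaleSkinnerTianWan2024, status: under-review]
[cite: BurungaleSkinnerTianWan2024, Thm. 10.10 (a) (p. 89) with statement 9.3 (b) (p. 80) and Lemma 9.16 (i) (p. 82) (OPEN binder; bookkeeping)] -/
theorem charIdealLePadicLFunctionRat_of_thm1010a_OPEN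
    (hBSTW_OPEN : thm1010a_mainStatement_semistable_ordinary_OPEN)
    (W : WeierstrassCurve ℚ) [W.IsElliptic] [W.IsGloballyMinimal] (p : ℕ) [Fact p.Prime]
    (hp : p ≠ 2) (hsst : Semistable W) (hgood : W.HasGoodReductionAtPrime p)
    (hord : ¬ (p : ℤ) ∣ W.frobeniusTrace p) (hirr : W.HasIrreducibleModPGaloisRep p) :
    CharIdealLePadicLFunctionRat W p :=
  charIdealLePadicLFunctionRat_of_charIdealEq (hBSTW_OPEN W p hp hsst hgood hord hirr)

/-- **Granted the twist binder: the one-sided rational ordinary predicate for a prime-to-`Np`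
quadratic twist** `W` of a semistable `W₀` (good ordinary at `p ≠ 2`, `E₀[p]` irreducible).
CONDITIONAL; closes nothing. [claim: BurungaleSkinnerTianWan2024, status: under-review]
[cite: BurungaleSkinnerTianWan2024, Thm. 10.10, last sentence (p. 89) (OPEN binder; bookkeeping)] -/
theorem charIdealLePadicLFunctionRat_twist_of_thm1010_OPEN
    (hBSTW_OPEN : thm1010_twist_mainStatement_OPEN)
    (W₀ W : WeierstrassCurve ℚ) [W₀.IsElliptic] [W₀.IsGloballyMinimal] [W.IsElliptic]
    [W.IsGloballyMinimal] (p : ℕ) [Fact p.Prime] {d : ℤ} {C : VariableChange ℚ}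
    (hp : p ≠ 2) (hsst : Semistable W₀) (hgood : W₀.HasGoodReductionAtPrime p)
    (hord : ¬ (p : ℤ) ∣ W₀.frobeniusTrace p) (hirr : W₀.HasIrreducibleModPGaloisRep p)
    (hd : Squarefree d) (hd1 : d ≠ 1)
    (hram : ∀ (q : ℕ) [Fact q.Prime], RamifiedInQuadratic d q → q ≠ p ∧ ¬ q ∣ W₀.conductorNorm ℤ)
    (hC : C • W = W₀.quadraticTwist (d : ℚ)) : CharIdealLePadicLFunctionRat W p :=
  charIdealLePadicLFunctionRat_of_charIdealEq
    (hBSTW_OPEN W₀ W p d C hp hsst hgood hord hirr hd hd1 hram hC)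

/-! ### The kernel corollary: the `p`-converse for SEMISTABLE curves at every `p ≥ 3` under (irr_ℚ),
WITHOUT (ram), modulo three preprint binders + REFEREED print -/

/-- **(Heeg) ⟹ (coprime)** (private twin of the sibling files' helper; BSTW (9.9)). [folklore] -/
private theorem isCoprime_discr_of_satisfiesHeegnerHypothesis''' {K : Type*} [Field K]
    [NumberField K] (hK : IsImaginaryQuadratic K) {N : ℕ} (hH : SatisfiesHeegnerHypothesis N K) :
    IsCoprime (NumberField.discr K) (N : ℤ) := by
  refine IsCoprime.symm ?_
  rw [Int.isCoprime_iff_gcd_eq_one, Int.gcd_eq_natAbs, Int.natAbs_natCast]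
  refine Nat.Coprime.gcd_eq_one (Nat.coprime_of_dvd fun k hk hkN hkd ↦ ?_)
  exact not_dvd_discr_of_satisfiesHeegnerHypothesis hK hH hk hkN (Int.ofNat_dvd_left.mpr hkd)

/-- **COROLLARY OF THE PAPER'S OWN STATEMENTS (Thm. 10.10 (a) + Prop. 12.1) — NOT a transcription of
Thm. 12.3** (which asks (ram) at `p = 3`): for `W/ℚ` globally minimal and SEMISTABLE, `p ≠ 2` a prime
of good ordinary reduction with `E[p]` irreducible, `corank_{ℤ_p} Sel_{p^∞}(E/ℚ) = 1 ∧ #Ш(E/ℚ)[p^∞] < ∞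
⟹ ord_{s=1} L(E, s) = 1`, granted the THREE preprint binders `h121` (Prop. 12.1, ordinary),
`h1010` (Thm. 10.10 (a), semistable), `h1010t` (its twist clause) — all PREPRINT, NEVER theorems — and
the REFEREED `p`-parity theorem, Friedberg–Hoffstein, Kato 14.2 and modularity. Proof = the printed
proof of Thm. 12.3 (p. 96, steps 1–6) with step 5 read "By Theorem 10.10 (a) … Kato's main conjecture
holds for `g` and for `g' = g ⊗ χ_L`": the Friedberg–Hoffstein field `L` has `(D_L, Np) = 1` by (ord) +
(Heeg) (every prime ramified in `ℚ(√m)`, `m` the squarefree kernel of `D_L`, divides `D_L`: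
`exists_isGloballyMinimal_twist_models`). At `p = 3` this is the only typed road for semistable curves
WITHOUT a ramified multiplicative prime; with (ram) see
`analyticRank_eq_one_of_prop121_ordinary_OPEN_of_skinnerUrban_of_selmerCorank_eq_one` (Skinner–Urban,
PUB\* at `3`), at `p ≥ 5` see gen 5's BCS25 version. [claim: BurungaleSkinnerTianWan2024, status: under-review]
[cite: BurungaleSkinnerTianWan2024, Thm. 10.10 (a) (p. 89; OPEN binders), Prop. 12.1 (p. 95; OPEN binder) and the proof of Thm. 12.3 (p. 96, tex l.8165–8177) (corollary; not a printed statement)] -/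
theorem analyticRank_eq_one_of_prop121_ordinary_OPEN_of_thm1010_OPEN_of_selmerCorank_eq_one
    (h121 : prop121_pConverse_of_charIdealLe_ordinary_OPEN.{0})
    (h1010 : thm1010a_mainStatement_semistable_ordinary_OPEN)
    (h1010t : thm1010_twist_mainStatement_OPEN)
    (hpar : ∀ (W : WeierstrassCurve ℚ) [W.IsElliptic] (p : ℕ) [Fact p.Prime], p_parity W p)
    (hFH : friedbergHoffstein_exists_heegnerField_split_twist_ne_zero)
    (hKato : ∀ (W : WeierstrassCurve ℚ) [W.IsElliptic] (p : ℕ) [Fact p.Prime],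
      kato_finite_of_L_one_ne_zero W p)
    (hE : hasEntireLFunction_rat)
    (W : WeierstrassCurve ℚ) [W.IsElliptic] [W.IsGloballyMinimal] (p : ℕ) [Fact p.Prime]
    (hp2 : p ≠ 2) (hsst : Semistable W) (hgood : W.HasGoodReductionAtPrime p)
    (hord : ¬ (p : ℤ) ∣ W.frobeniusTrace p) (hirr : W.HasIrreducibleModPGaloisRep p)
    (hcorank : W.selmerCorank p = 1)
    (hsha : Finite (AddCommGroup.primaryComponent W.sha p)) : W.analyticRank = 1 := by
  have hpP : p.Prime := Fact.out
  -- step 1: parity, `w(E) = -1`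
  have hw : W.rootNumber = -1 := by
    have h := hpar W p
    unfold p_parity at h
    rw [hcorank, pow_one] at h
    exact h.symm
  haveI := hsha
  have hrank : W.mordellWeilRank = 1 := mordellWeilRank_eq_one_of_selmerCorank_eq_one W p hcorank
  -- step 2: the Friedberg–Hoffstein field
  obtain ⟨K, _, _, hK, -, hHN, hHp, hL1⟩ := hFH W hw p hpP 0
  have hsplit : ((Ideal.span {(p : ℤ)}).primesOver (𝓞 K)).ncard = 2 := hHp p hpP dvd_rfl
  have hcop : IsCoprime (NumberField.discr K) (W.conductorNorm ℤ) :=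
    isCoprime_discr_of_satisfiesHeegnerHypothesis''' hK hHN
  have hpd : ¬ (p : ℤ) ∣ NumberField.discr K :=
    not_dvd_discr_of_satisfiesHeegnerHypothesis hK hHp hpP dvd_rfl
  -- steps 3–4: Kato for the twist and base change
  obtain ⟨hrankK, -, hshaK⟩ :=
    AcPConverseLinks.rank_corank_sha_baseChange_of_twist_L_one_ne_zero hKato W p hK hL1 hrank hsha
  -- a globally minimal model `W'` of `E^{(d_K)}` = the twist by the squarefree kernel `m` of `d_K`
  obtain ⟨W', _, _, C, C', m, hC, hC', hsq, hm1, -, hram⟩ :=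
    exists_isGloballyMinimal_twist_models W hK.1
  -- «(D_K, Np) = 1»: the primes ramified in `ℚ(√m) = K` divide `d_K`
  have hram' : ∀ (q : ℕ) [Fact q.Prime], RamifiedInQuadratic m q →
      q ≠ p ∧ ¬ q ∣ W.conductorNorm ℤ := by
    intro q hq hq'
    have hqd : (q : ℤ) ∣ NumberField.discr K := hram q hq.out hq'
    refine ⟨?_, fun hqN ↦ not_dvd_discr_of_satisfiesHeegnerHypothesis hK hHN hq.out hqN hqd⟩
    rintro rfl
    exact hpd hqd
  -- step 5: Thm. 10.10 (a) for `E` and its twist clause for `E^{(d_K)}`, then the one-sided halves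
  have hle : CharIdealLePadicLFunctionRat W p :=
    charIdealLePadicLFunctionRat_of_thm1010a_OPEN h1010 W p hp2 hsst hgood hord hirr
  have hle' : CharIdealLePadicLFunctionRat W' p :=
    charIdealLePadicLFunctionRat_twist_of_thm1010_OPEN h1010t W W' p hp2 hsst hgood hord hirr hsq hm1
      hram' hC'
  -- step 6: Prop. 12.1 (rank form) and the factorisation of `ord L(E/K)`
  have hEK : analyticRankEK W K = 1 :=
    analyticRankEK_eq_one_of_prop121_ordinary_OPEN_of_mordellWeilRank_eq_one h121 W W' K p hp2 hgood
      hord hK hsplit hcop hHN hC hle hle' hrankK hshaK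
  rw [analyticRankEK_eq_add_of hE W K, analyticRank_eq_zero_of_entireLFunction_one_ne_zero _ hL1,
    add_zero] at hEK
  exact hEK

/-- **The same corollary in RANK form**: for `W/ℚ` globally minimal and semistable, `p ≠ 2` good
ordinary with `E[p]` irreducible, `rank_ℤ E(ℚ) = 1 ∧ #Ш(E/ℚ)[p^∞] < ∞ ⟹ ord_{s=1} L(E, s) = 1`, granted
the three preprint binders and named print. COROLLARY of Thm. 10.10 (a) + Prop. 12.1, not a printed
statement. [claim: BurungaleSkinnerTianWan2024, status: under-review]
[cite: BurungaleSkinnerTianWan2024, Thm. 10.10 (a) (p. 89; OPEN binders), Prop. 12.1 (p. 95; OPEN binder), proof of Thm. 12.3 (p. 96) (corollary)] -/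
theorem analyticRank_eq_one_of_prop121_ordinary_OPEN_of_thm1010_OPEN_of_mordellWeilRank_eq_one
    (h121 : prop121_pConverse_of_charIdealLe_ordinary_OPEN.{0})
    (h1010 : thm1010a_mainStatement_semistable_ordinary_OPEN)
    (h1010t : thm1010_twist_mainStatement_OPEN)
    (hpar : ∀ (W : WeierstrassCurve ℚ) [W.IsElliptic] (p : ℕ) [Fact p.Prime], p_parity W p)
    (hFH : friedbergHoffstein_exists_heegnerField_split_twist_ne_zero)
    (hKato : ∀ (W : WeierstrassCurve ℚ) [W.IsElliptic] (p : ℕ) [Fact p.Prime],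
      kato_finite_of_L_one_ne_zero W p)
    (hE : hasEntireLFunction_rat)
    (W : WeierstrassCurve ℚ) [W.IsElliptic] [W.IsGloballyMinimal] (p : ℕ) [Fact p.Prime]
    (hp2 : p ≠ 2) (hsst : Semistable W) (hgood : W.HasGoodReductionAtPrime p)
    (hord : ¬ (p : ℤ) ∣ W.frobeniusTrace p) (hirr : W.HasIrreducibleModPGaloisRep p)
    (hrank : W.mordellWeilRank = 1)
    (hsha : Finite (AddCommGroup.primaryComponent W.sha p)) : W.analyticRank = 1 := by
  haveI := hsha
  exact analyticRank_eq_one_of_prop121_ordinary_OPEN_of_thm1010_OPEN_of_selmerCorank_eq_one h121 h1010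
    h1010t hpar hFH hKato hE W p hp2 hsst hgood hord hirr
    (selmerCorank_eq_one_of_mordellWeilRank_eq_one_of_finite W p hrank hsha) hsha

/-! ### (appended, v2) The rank-ONE `p`-part for SEMISTABLE curves without (ram): Prop. 11.11 +
Thm. 10.10 (a), three preprint binders -/

/-- **COROLLARY OF THE PAPER'S OWN STATEMENTS (Prop. 11.11 + Thm. 10.10 (a)) — NOT a transcription of
Thm. 11.12** (whose ordinary branch asks (ram)): for `W/ℚ` globally minimal and SEMISTABLE, `p ≠ 2` a
prime of good ordinary reduction with `E[p]` irreducible, `ord_{s=1} L(E, s) = 1`, a Heegner field `K`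
(imaginary quadratic, `p` split, every `ℓ ∣ N_E` split, `ord_{s=1} L(E/K, s) = 1` as `LDerivEK W K ≠ 0`)
and ANY globally minimal model `W'` of `E^{(d_K)}`: Miller's `BSD(E,p)` (`BSDp W p`), granted the
THREE preprint binders `h1111` (Prop. 11.11, ordinary; gen 2), `h1010` (Thm. 10.10 (a), semistable),
`h1010t` (its twist clause) — all PREPRINT, NEVER theorems — and modularity (`hmod`) + GZK (`hGZK`).
Side conditions of the Prop. 11.11 binder DERIVED here: (coprime) from (Heeg); (van_ℚ)
`p ∤ #E(ℚ)_tors` and (van_L)'s twist half `p ∤ #E^{(d_K)}(ℚ)_tors` from the irreducibility of `E[p]`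
and of `E^{(d_K)}[p]` (`not_hasIrreducibleModPGaloisRep_of_dvd_torsionOrder`,
`hasIrreducibleModPGaloisRep_of_smul_eq_quadraticTwist`); the twist binder's "`(D_K, Np) = 1`" from
(ord) + (Heeg) through the squarefree kernel of `d_K` (`exists_squarefree_discr_eq_mul_sq`). At `p = 3`
this is a typed road for semistable rank-one curves WITHOUT a ramified multiplicative prime (all
inputs = the preprint's announced statements + refereed print).
[claim: BurungaleSkinnerTianWan2024, status: under-review]
[cite: BurungaleSkinnerTianWan2024, Prop. 11.11 (pp. 94–95; OPEN binder) and Thm. 10.10 (a) (p. 89; OPEN binders) (corollary; not a printed statement)]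
[cite: Miller2011LMS, Def. 1.1] -/
theorem bsdp_rankOne_of_prop1111_OPEN_of_thm1010_OPEN
    (h1111 : prop1111_pPart_rankOne_of_mainStatements_ordinary_OPEN)
    (h1010 : thm1010a_mainStatement_semistable_ordinary_OPEN)
    (h1010t : thm1010_twist_mainStatement_OPEN)
    (hmod : hasEntireLFunction_rat) (hGZK : rank_eq_analyticRank_of_analyticRank_le_one)
    (W W' : WeierstrassCurve ℚ) [W.IsElliptic] [W.IsGloballyMinimal] [W'.IsElliptic]
    [W'.IsGloballyMinimal] (p : ℕ) [Fact p.Prime] (K : Type) [Field K] [NumberField K]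
    {C : VariableChange ℚ} (hp2 : p ≠ 2) (hsst : Semistable W) (hgood : W.HasGoodReductionAtPrime p)
    (hord : ¬ (p : ℤ) ∣ W.frobeniusTrace p) (hirr : W.HasIrreducibleModPGaloisRep p)
    (hr : W.analyticRank = 1) (hK : IsImaginaryQuadratic K)
    (hsplit : ((Ideal.span {(p : ℤ)}).primesOver (𝓞 K)).ncard = 2)
    (hH : SatisfiesHeegnerHypothesis (W.conductorNorm ℤ) K) (hL : LDerivEK W K ≠ 0)
    (hC : C • W' = W.quadraticTwist (NumberField.discr K : ℚ)) : BSDp W p := by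
  have hpP : p.Prime := Fact.out
  haveI : NeZero (W.conductorNorm ℤ) := ⟨(W.conductorNorm_pos_holds).ne'⟩
  have hcop : IsCoprime (NumberField.discr K) (W.conductorNorm ℤ) :=
    isCoprime_discr_of_satisfiesHeegnerHypothesis''' hK hH
  have hpd : ¬ (p : ℤ) ∣ NumberField.discr K :=
    not_dvd_discr_of_satisfiesHeegnerHypothesis hK (fun q hq hqp ↦ by
      rwa [(Nat.prime_dvd_prime_iff_eq hq hpP).mp hqp]) hpP dvd_rfl
  -- the twist by the squarefree kernel `m` of `d_K`, and «(D_K, Np) = 1»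
  obtain ⟨m, f, hsq, hm1, hf, hdK, hram⟩ := exists_squarefree_discr_eq_mul_sq hK.1
  have hfQ : (f : ℚ) ≠ 0 := by exact_mod_cast hf
  obtain ⟨C₀, hC₀⟩ := W.exists_variableChange_quadraticTwist_mul_sq (m : ℚ) (f : ℚ) hfQ
  have hcast : (NumberField.discr K : ℚ) = (m : ℚ) * (f : ℚ) ^ 2 := by
    rw [hdK]; push_cast; ring
  have hC' : (C₀⁻¹ * C) • W' = W.quadraticTwist (m : ℚ) := by
    rw [mul_smul, hC, hcast, ← hC₀, inv_smul_smul]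
  have hram' : ∀ (q : ℕ) [Fact q.Prime], RamifiedInQuadratic m q →
      q ≠ p ∧ ¬ q ∣ W.conductorNorm ℤ := by
    intro q hq hq'
    have hqd : (q : ℤ) ∣ NumberField.discr K := hram q hq.out hq'
    refine ⟨?_, fun hqN ↦ not_dvd_discr_of_satisfiesHeegnerHypothesis hK hH hq.out hqN hqd⟩
    rintro rfl
    exact hpd hqd
  -- Thm. 10.10 (a) for `E` and its twist clause for `E^{(d_K)}`
  have hMC : CharIdealEqPadicLFunctionNeron W p := h1010 W p hp2 hsst hgood hord hirr
  have hMC' : CharIdealEqPadicLFunctionNeron W' p :=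
    h1010t W W' p m (C₀⁻¹ * C) hp2 hsst hgood hord hirr hsq hm1 hram' hC'
  -- (van_ℚ) and the twist half of (van_L) from irreducibility
  have hd0 : (NumberField.discr K : ℚ) ≠ 0 := by exact_mod_cast NumberField.discr_ne_zero K
  have hirr' : W'.HasIrreducibleModPGaloisRep p :=
    hasIrreducibleModPGaloisRep_of_smul_eq_quadraticTwist W W' p hd0 hC hirr
  have hvan : ¬ p ∣ W.torsionOrder := fun h ↦
    not_hasIrreducibleModPGaloisRep_of_dvd_torsionOrder W p h hirr
  have hvan' : ¬ p ∣ W'.torsionOrder := fun h ↦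
    not_hasIrreducibleModPGaloisRep_of_dvd_torsionOrder W' p h hirr'
  exact bsdp_of_prop1111_OPEN W W' p h1111 hmod hGZK hp2 hgood hord hr hvan hK hsplit hcop hH hL hC
    hvan' hMC hMC'

end Literature.NumberTheory.EllipticCurves.BurungaleSkinnerTianWan2024

end
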